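import Summits.FinalStateConjecture.FinalStateConjecture.Theorems.EIHFluxBalanceInertialRecessionStubRechart12Clock
import Summits.FinalStateConjecture.FinalStateConjecture.Theorems.EIHFluxBalanceInertialRecessionStubRechart3Package
import Summits.FinalStateConjecture.FinalStateConjecture.Theorems.EIHFluxBalanceInertialRecessionStubRechart3Disjoint

/-!
# Route EIHFluxBalance — `InertialRecession` (E′), re-charting on the given region: the CLOCK-CHART
# PACKAGES of all holes in the form the on-region assembly consumes

Helper file for the crux `stmt-FinalStateConjecture-17403`
(`Summit.FinalStateConjecture.FinalStateConjecture.Theses.EIHFluxBalance.InertialRecession`, E′),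
line `SketchCleanExcision`, stub `stub_rechartOnRegion` (P2′).

`clockCharts_packages_r12`: for every hole the rest-frame clock chart of `clockChart_package`
(…StubRechart3Package) built after the lab time `TO` of (Ofut), together with its dictionary
(…StubRechart12Clock: lab clock `θᵢ`, tilt `βᵢ`, slack dichotomy, coverage stages with the sharp
time clause, inner dictionary, reach profile `Rrᵢ` with the certified Carter reach) and the eventual
disjointness of the boosted tubes (`eventually_disjoint_truncLateRegion_images`, …StubRechart3Disjoint),
packaged as families over `i : Fin N` — exactly the per-hole hypotheses of
`exists_finalStateDecomposition_onRegion_of_clockCharts` (…StubRechart12Assembly). Painted radii are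
stated for the painted frames `Λᵢ` (the normalised frames `Λ̃ᵢ` have the same painted radii).
[folklore]
-/

noncomputable section

set_option linter.dupNamespace false

open Set Filter Topology Function TopologicalSpace Literature.Geometry.Lorentzian
open Summit.FinalStateConjecture.FinalStateConjecture.Theorems.SublinearIsFree.Rechart
open scoped Manifold ContDiff ENNReal BigOperators

namespace Summit.FinalStateConjecture.FinalStateConjecture.Theorems

/-- A proper-time clock tends to `+∞` (registered carrier `tendsto_clock_rechart12` of the crux
item): `τ − 0 ≤ T₀ τ − T₀ 0`. [folklore] -/
theorem tendsto_clock_rechart12 : open Filter in ∀ {T₀ : ℝ → ℝ}, (∀ σ τ : ℝ, σ ≤ τ → τ - σ ≤ T₀ τ - T₀ σ) → Tendsto T₀ atTop atTop := by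
  intro T₀ hlo
  refine tendsto_atTop_mono' atTop ?_ (tendsto_atTop_add_const_right atTop (T₀ 0) tendsto_id)
  filter_upwards [eventually_ge_atTop 0] with τ hτ
  have := hlo 0 τ hτ
  show τ + T₀ 0 ≤ T₀ τ
  linarith

-- the assembly is long
set_option maxHeartbeats 1600000 in
/-- **The clock-chart packages of all holes.** See the module docstring. [folklore] -/
theorem clockCharts_packages_r12 (𝓢 : Spacetime 4) {N : ℕ} (M a rin : Fin N → ℝ)
    (Λ Λt : Fin N → ℝ → lorentzGroup) (ξ : Fin N → ℝ → E3)
    (hsub : ∀ i, Kerr.IsSubextremal (M i) (a i)) (hrin : ∀ j, rin j < Kerr.rPlus (M j) (a j))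
    (hbil : ∀ j t x, boostedKerrBilin (Λt j t) (E4.ofTimeSpace t (ξ j t)) (M j) (a j) x =
      boostedKerrBilin (Λ j t) (E4.ofTimeSpace t (ξ j t)) (M j) (a j) x)
    (hrad : ∀ j t x, Kerr.radius (a j) (poincareInv (Λt j t) (E4.ofTimeSpace t (ξ j t)) x) =
      Kerr.radius (a j) (poincareInv (Λ j t) (E4.ofTimeSpace t (ξ j t)) x))
    (hΛ : ∀ j, ContDiff ℝ ∞ (fun t ↦ ((Λ j t : E4 ≃L[ℝ] E4) : E4 →L[ℝ] E4)))
    (hξ : ∀ j, ContDiff ℝ ∞ (ξ j))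
    (hΛt : ∀ j, ContDiff ℝ ∞ (fun t ↦ ((Λt j t : E4 ≃L[ℝ] E4) : E4 →L[ℝ] E4)))
    (hdec : ∀ j m, 1 ≤ m → m ≤ 3 → Tendsto (fun t ↦ iteratedDeriv m
      (fun s ↦ ((Λt j s : E4 ≃L[ℝ] E4) : E4 →L[ℝ] E4)) t) atTop (𝓝 0))
    {γ : ℝ} (hγ1 : 1 ≤ γ) (huγ : ∀ j t, |((Λt j t : E4 ≃L[ℝ] E4) (E4.basisVector 0)) 0| ≤ γ)
    (hpos : ∀ j t, 0 < ((Λt j t : E4 ≃L[ℝ] E4) (E4.basisVector 0)) 0)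
    (hmis : ∀ j, ∀ m : ℕ, m ≤ 2 → Tendsto (fun t ↦ iteratedDeriv m (fun s ↦ deriv (ξ j) s -
      ((((Λt j s : E4 ≃L[ℝ] E4) (E4.basisVector 0)) 0)⁻¹ •
        E4.spatial ((Λt j s : E4 ≃L[ℝ] E4) (E4.basisVector 0)))) t) atTop (𝓝 0))
    (hsep : ∀ i j, i ≠ j → Tendsto (fun t ↦ ‖ξ i t - ξ j t‖) atTop atTop)
    (U : Opens E4) (Φ : U → 𝓢.carrier) (hΦ : ContMDiff 𝓘(ℝ, E4) (𝓡 4) ∞ Φ)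
    (hdev : Tendsto (fun t ↦ 𝓢.deviationCk ⟨U, fun x ↦ Minkowski.bilin +
      ∑ i, (boostedKerrBilin (Λ i (x 0)) (E4.ofTimeSpace (x 0) (ξ i (x 0))) (M i) (a i) x -
        Minkowski.bilin), fun x ↦ x 0, E4.spatialNorm⟩ Φ 3 t) atTop (𝓝 0))
    {τ₀ TO : ℝ} (hτTO : τ₀ ≤ TO)
    (hU : {x : E4 | τ₀ < x 0 ∧ ∀ j, rin j < Kerr.radius (a j)
      (poincareInv (Λ j (x 0)) (E4.ofTimeSpace (x 0) (ξ j (x 0))) x)} ⊆ (U : Set E4))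
    (hembΦ : IsOpenEmbedding (({x : U | τ₀ < x.1 0} : Set U).restrict Φ))
    (Q : U → Prop)
    (hQof : ∀ x : U, TO < x.1 0 → (∀ j, Kerr.rPlus (M j) (a j) <
      Kerr.radius (a j) (poincareInv (Λ j (x.1 0)) (E4.ofTimeSpace (x.1 0) (ξ j (x.1 0))) x.1)) → Q x)
    (hOfut : ∀ x : U, Q x → ∀ w : E4, 0 < w 0 →
      𝓢.metric.val (Φ x) (mfderiv 𝓘(ℝ, E4) (𝓡 4) Φ x w) (mfderiv 𝓘(ℝ, E4) (𝓡 4) Φ x w) < 0 →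
        𝓢.timeOrientation.IsFutureDirected (mfderiv 𝓘(ℝ, E4) (𝓡 4) Φ x w))
    (V : Fin N → E3) (hV1 : ∀ i, ‖V i‖ < 1) :
    ∃ (A : Fin N → E4 → E4) (hAU : ∀ i, ∀ y ∈ boostedKerrExterior 1 0 (M i) (a i), A i y ∈ U)
      (T₀ θ β Rr : Fin N → ℝ → ℝ) (S Tlab : Fin N → ℝ) (tcov : Fin N → ℕ → ℝ),
      (∀ i, ContDiff ℝ ∞ (A i)) ∧ (∀ i (y : E4), TO < A i y 0) ∧
      (∀ i, ∀ y ∈ boostedKerrExterior 1 0 (M i) (a i), ∀ j, Kerr.rPlus (M j) (a j) <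
        Kerr.radius (a j) (poincareInv (Λ j (A i y 0)) (E4.ofTimeSpace (A i y 0) (ξ j (A i y 0))) (A i y))) ∧
      (∀ (i : Fin N) (y : E4) (hy : y ∈ boostedKerrExterior 1 0 (M i) (a i)), Q ⟨A i y, hAU i y hy⟩) ∧
      (∀ i, IsOpenEmbedding (fun y : boostedKerrExterior 1 0 (M i) (a i) ↦ Φ ⟨A i y.1, hAU i y.1 y.2⟩)) ∧
      (∀ (i : Fin N) (R : ℝ), Tendsto (fun τ ↦ 𝓢.truncDeviationCk (boostedKerrBackground 1 0 (M i) (a i))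
        (fun y : boostedKerrExterior 1 0 (M i) (a i) ↦ Φ ⟨A i y.1, hAU i y.1 y.2⟩) 2 R τ) atTop (𝓝 0)) ∧
      (∀ i j, i ≠ j → ∀ R : ℝ, ∀ᶠ τ₁ in atTop, Disjoint
        (boostChart (Lorentz.boost (V i) (hV1 i)) (M i) (a i)
          (fun y : boostedKerrExterior 1 0 (M i) (a i) ↦ Φ ⟨A i y.1, hAU i y.1 y.2⟩) ''
            (boostedKerrBackground (Lorentz.boost (V i) (hV1 i)) 0 (M i) (a i)).truncLateRegion τ₁ R)
        (boostChart (Lorentz.boost (V j) (hV1 j)) (M j) (a j)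
          (fun y : boostedKerrExterior 1 0 (M j) (a j) ↦ Φ ⟨A j y.1, hAU j y.1 y.2⟩) ''
            (boostedKerrBackground (Lorentz.boost (V j) (hV1 j)) 0 (M j) (a j)).truncLateRegion τ₁ R)) ∧
      (∀ i, ContDiff ℝ ∞ (T₀ i)) ∧ (∀ i τ, deriv (T₀ i) τ = frameVel (Λt i (T₀ i τ)) 0) ∧
      (∀ i, Tendsto (T₀ i) atTop atTop) ∧
      (∀ (i : Fin N) (K : ℝ), ∃ τK : ℝ, ∀ y : E4, τK ≤ y 0 → ‖E4.spatial y‖ ≤ K →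
        A i =ᶠ[𝓝 y] honestChart (Λt i) (ξ i) (T₀ i)) ∧
      (∀ i, Tendsto (θ i) atTop atTop) ∧ (∀ i t, T₀ i 0 ≤ t → θ i t ≤ t - T₀ i 0) ∧
      (∀ i t, 0 ≤ β i t) ∧ (∀ i t, β i t ≤ (1 + |a i| / Kerr.rPlus (M i) (a i)) * γ) ∧
      (∀ i (n : ℕ), ∀ᶠ t in atTop, β i t * n ≤ (t - θ i t) + (1 + |T₀ i 0|)) ∧
      (∀ i, Monotone (Rr i)) ∧ (∀ i, Tendsto (Rr i) atTop atTop) ∧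
      (∀ i, Tendsto (fun τ ↦ 𝓢.truncDeviationCk (boostedKerrBackground 1 0 (M i) (a i))
        (fun y : boostedKerrExterior 1 0 (M i) (a i) ↦ Φ ⟨A i y.1, hAU i y.1 y.2⟩) 2 (Rr i τ) τ) atTop (𝓝 0)) ∧
      (∀ (i : Fin N) (y : boostedKerrExterior 1 0 (M i) (a i)) (τ₁ : ℝ), S i ≤ y.1 0 → y.1 0 ≤ τ₁ →
        Kerr.rPlus (M i) (a i) + 1 ≤ Kerr.radius (a i) y.1 → Kerr.radius (a i) y.1 ≤ Rr i (y.1 0) →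
        Φ ⟨A i y.1, hAU i y.1 y.2⟩ ∈ 𝓢.metric.causalPast 𝓢.timeOrientation
          ((fun y : boostedKerrExterior 1 0 (M i) (a i) ↦ Φ ⟨A i y.1, hAU i y.1 y.2⟩) ''
            {z | z.1 0 = τ₁ ∧ Kerr.radius (a i) z.1 ≤ Rr i τ₁})) ∧
      (∀ (i : Fin N) (n : ℕ) (x : E4), tcov i n ≤ x 0 → 16 * γ ^ 2 * n + 16 * γ ^ 2 * |a i| ≤ x 0 / 2 →
        Kerr.rPlus (M i) (a i) < Kerr.radius (a i) (poincareInv (Λ i (x 0)) (E4.ofTimeSpace (x 0) (ξ i (x 0))) x) →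
        Kerr.radius (a i) (poincareInv (Λ i (x 0)) (E4.ofTimeSpace (x 0) (ξ i (x 0))) x) ≤ n →
        ∃ y : E4, A i y = x ∧
          Kerr.radius (a i) y = Kerr.radius (a i) (poincareInv (Λ i (x 0)) (E4.ofTimeSpace (x 0) (ξ i (x 0))) x) ∧
          |y 0 - θ i (x 0)| ≤ β i (x 0) *
            Kerr.radius (a i) (poincareInv (Λ i (x 0)) (E4.ofTimeSpace (x 0) (ξ i (x 0))) x)) ∧
      (∀ (i : Fin N) (y : E4), Tlab i ≤ A i y 0 → Kerr.radius (a i) y < Kerr.rPlus (M i) (a i) + 1 →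
        Kerr.radius (a i) (poincareInv (Λ i (A i y 0)) (E4.ofTimeSpace (A i y 0) (ξ i (A i y 0))) (A i y)) =
          Kerr.radius (a i) y) := by
  classical
  have hγ0 : 0 ≤ γ := zero_le_one.trans hγ1
  have hrp0 : ∀ i, 0 < Kerr.rPlus (M i) (a i) := fun i ↦ by
    have h1 : 0 < M i := (hsub i).pos
    unfold Kerr.rPlus; linarith [Real.sqrt_nonneg (M i ^ 2 - a i ^ 2)]
  -- ### the clock-chart packages
  set Bf : ModelBackground := ⟨U, fun x ↦ Minkowski.bilin +
      ∑ i, (boostedKerrBilin (Λ i (x 0)) (E4.ofTimeSpace (x 0) (ξ i (x 0))) (M i) (a i) x -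
        Minkowski.bilin), fun x ↦ x 0, E4.spatialNorm⟩ with hBf
  set H : Fin N → E4 → E4 →L[ℝ] E4 →L[ℝ] ℝ := fun j z ↦ boostedKerrBilin (Λ j (z 0))
    (E4.ofTimeSpace (z 0) (ξ j (z 0))) (M j) (a j) z - Minkowski.bilin with hH
  have hpack := fun i : Fin N ↦ clockChart_package 𝓢 i M a Λ ξ Λt hbil hrad (H := H) (fun j z ↦ rfl)
    (Bb := Bf.bilin) (fun z ↦ rfl) hΛ hξ hΛt hdec hγ1 huγ hpos hmis (fun j hj ↦ hsep i j (Ne.symm hj)) U Φ hΦ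
    hdev hrin hU (hrp0 i) TO hτTO
  choose T₀ ρ' C A hAU hP using hpack
  have hT₀s : ∀ i, ContDiff ℝ ∞ (T₀ i) := fun i ↦ (hP i).1
  have hclockH : ∀ i τ, HasDerivAt (T₀ i) (frameVel (Λt i (T₀ i τ)) 0) τ := fun i ↦ (hP i).2.1
  have hT₀lo : ∀ i σ τ, σ ≤ τ → τ - σ ≤ T₀ i τ - T₀ i σ := fun i σ τ h ↦ ((hP i).2.2.1 σ τ h).1
  have hT₀hi : ∀ i σ τ, σ ≤ τ → T₀ i τ - T₀ i σ ≤ γ * (τ - σ) := fun i σ τ h ↦ ((hP i).2.2.1 σ τ h).2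
  have hC0 : ∀ i y, y 0 ≤ C i y 0 := fun i ↦ by
    obtain ⟨-, -, -, -, -, -, -, h, -⟩ := hP i; exact h
  have hCle : ∀ i y, ‖E4.spatial (C i y)‖ ≤ ‖E4.spatial y‖ := fun i ↦ by
    obtain ⟨-, -, -, -, -, -, -, -, -, h, -⟩ := hP i; exact h
  have hAC : ∀ i y, A i y = honestChart (Λt i) (ξ i) (T₀ i) (C i y) := fun i ↦ by
    obtain ⟨-, -, -, -, -, -, -, -, -, -, -, h, -⟩ := hP i; exact h
  have hAc : ∀ i, ContDiff ℝ ∞ (A i) := fun i ↦ by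
    obtain ⟨-, -, -, -, -, -, -, -, -, -, -, -, h, -⟩ := hP i; exact h
  have hAe : ∀ i, IsOpenEmbedding (A i) := fun i ↦ by
    obtain ⟨-, -, -, -, -, -, -, -, -, -, -, -, -, h, -⟩ := hP i; exact h
  have hAlate : ∀ i (y : E4), TO < A i y 0 := fun i ↦ by
    obtain ⟨-, -, -, -, -, -, -, -, -, -, -, -, -, -, h, -⟩ := hP i; exact h
  have hAwin : ∀ i y, |A i y 0 - T₀ i (C i y 0)| ≤ 4 * γ * ‖E4.spatial (C i y)‖ := fun i ↦ by
    obtain ⟨-, -, -, -, -, -, -, -, -, -, -, -, -, -, -, h, -⟩ := hP i; exact h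
  have hAoff : ∀ i y, ‖E4.spatial (A i y) - ξ i (A i y 0)‖ ≤ (4 * γ + (4 * γ) ^ 2) * ‖E4.spatial (C i y)‖ :=
    fun i ↦ by
    obtain ⟨-, -, -, -, -, -, -, -, -, -, -, -, -, -, -, -, h, -⟩ := hP i; exact h
  have hradii : ∀ i, ∀ y ∈ boostedKerrExterior 1 0 (M i) (a i), ∀ j, Kerr.rPlus (M j) (a j) <
      Kerr.radius (a j) (poincareInv (Λ j (A i y 0)) (E4.ofTimeSpace (A i y 0) (ξ j (A i y 0))) (A i y)) :=
    fun i ↦ by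
    obtain ⟨-, -, -, -, -, -, -, -, -, -, -, -, -, -, -, -, -, h, -⟩ := hP i; exact h
  have hhon : ∀ (i : Fin N) (K : ℝ), ∃ τK : ℝ, ∀ y : E4, τK ≤ y 0 → ‖E4.spatial y‖ ≤ K →
      A i =ᶠ[𝓝 y] honestChart (Λt i) (ξ i) (T₀ i) := fun i ↦ by
    obtain ⟨-, -, -, -, -, -, -, -, -, -, -, -, -, -, -, -, -, -, -, h, -⟩ := hP i; exact h
  have hconvR : ∀ (i : Fin N) (R : ℝ), Tendsto (fun τ ↦ 𝓢.truncDeviationCk (boostedKerrBackground 1 0 (M i) (a i))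
      (fun y : boostedKerrExterior 1 0 (M i) (a i) ↦ Φ ⟨A i y.1, hAU i y.1 y.2⟩) 2 R τ) atTop (𝓝 0) :=
    fun i R ↦ by
    obtain ⟨-, -, -, -, -, -, -, -, -, -, -, -, -, -, -, -, -, -, -, -, h⟩ := hP i
    exact h _ (fun _ ↦ rfl) R
  -- derived clock facts
  have hclock : ∀ i τ, deriv (T₀ i) τ = frameVel (Λt i (T₀ i τ)) 0 := fun i τ ↦ (hclockH i τ).deriv
  have htop : ∀ i, Tendsto (T₀ i) atTop atTop := fun i ↦ tendsto_clock_rechart12 (hT₀lo i)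
  have hT₀m : ∀ i, Monotone (T₀ i) := fun i σ τ h ↦ by have := hT₀lo i σ τ h; linarith
  have hposF : ∀ i t, 0 < frameVel (Λt i t) 0 := fun i t ↦ hpos i t
  have hdecT : ∀ i, Tendsto (fun t ↦ deriv (fun s ↦ frameTilt (Λt i s)) t) atTop (𝓝 0) := fun i ↦ by
    have h := tendsto_iteratedDeriv_frameTilt (Λt i) (hΛt i) (hdec i) 1 le_rfl (by norm_num)
    simpa only [iteratedDeriv_one] using h
  -- chart points satisfy `Q`
  have hQA : ∀ (i : Fin N) (y : E4) (hy : y ∈ boostedKerrExterior 1 0 (M i) (a i)), Q ⟨A i y, hAU i y hy⟩ :=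
    fun i y hy ↦ hQof _ (hAlate i y) (hradii i y hy)
  -- ### the dictionaries
  have hL : ∀ i, 1 ≤ 1 + |a i| / Kerr.rPlus (M i) (a i) := fun i ↦
    le_add_of_nonneg_right (div_nonneg (abs_nonneg _) (hrp0 i).le)
  have hdict := fun i ↦ exists_clockDictionary_r12 (Λt i) (T₀ i) (hΛt i) (hdec i) hγ1 (huγ i) (hpos i)
    (hclockH i) (hT₀lo i) (hT₀hi i) (hL i)
  choose θ β hθT hTθ hθm hθ1 hθtop hθbd hβ0 hβB hβdom hslack using hdict
  -- coverage stages
  have hcovex := fun (i : Fin N) (n : ℕ) ↦ clock_coverage_r12 (Λt i) (ξ i) (T₀ i) (hΛt i) (hT₀s i) hγ1 (huγ i)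
    (hT₀lo i) (a i) (hhon i) (hθT i) (hθm i) (hθ1 i) (hrp0 i) (hβdom i) (n : ℝ)
  choose tcov htcov using hcovex
  -- inner dictionary
  have hlabex := fun i : Fin N ↦ clock_innerDictionary_r12 (Λt i) (ξ i) (T₀ i) (hΛt i) (hT₀s i) hγ1 (huγ i)
    (hT₀lo i) (a i) (hhon i) (hAC i) (hCle i) (hAe i).injective (Kerr.rPlus (M i) (a i) + 1)
  choose Tlab hTlab using hlabex
  -- reach
  have hreachex := fun i : Fin N ↦ exists_clock_reach_r12 U Φ hΦ Q hOfut (hsub i) (Λt i) (ξ i) (T₀ i) (hΛt i)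
    (hξ i) (hT₀s i) (hclock i) (hposF i) (hdecT i) (htop i) (hAc i) (hAU i) (hhon i) (hQA i) (hconvR i)
  choose Rr S hRrm hRrt hRrc hreach using hreachex
  -- ### disjointness of the boosted tubes
  have hinj : InjOn Φ {x : U | τ₀ < x.1 0} := by
    intro x hx y hy hxy
    have h := hembΦ.injective (a₁ := ⟨x, hx⟩) (a₂ := ⟨y, hy⟩) hxy
    exact congrArg Subtype.val h
  have hAlate0 : ∀ i (y : E4), τ₀ < A i y 0 := fun i y ↦ hτTO.trans_lt (hAlate i y)
  have hdisjB : ∀ i j, i ≠ j → ∀ R : ℝ, ∀ᶠ τ₁ in atTop, Disjoint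
      (boostChart (Lorentz.boost (V i) (hV1 i)) (M i) (a i)
        (fun y : boostedKerrExterior 1 0 (M i) (a i) ↦ Φ ⟨A i y.1, hAU i y.1 y.2⟩) ''
          (boostedKerrBackground (Lorentz.boost (V i) (hV1 i)) 0 (M i) (a i)).truncLateRegion τ₁ R)
      (boostChart (Lorentz.boost (V j) (hV1 j)) (M j) (a j)
        (fun y : boostedKerrExterior 1 0 (M j) (a j) ↦ Φ ⟨A j y.1, hAU j y.1 y.2⟩) ''
          (boostedKerrBackground (Lorentz.boost (V j) (hV1 j)) 0 (M j) (a j)).truncLateRegion τ₁ R) :=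
    fun i j hij R ↦ eventually_disjoint_truncLateRegion_images 𝓢 i j M a ξ U Φ hinj (Lorentz.boost (V i) (hV1 i))
      (Lorentz.boost (V j) (hV1 j)) hγ0 (by positivity : (0 : ℝ) ≤ 4 * γ + (4 * γ) ^ 2) (hAU i) (hAU j)
      (hAlate0 i) (hAlate0 j) (hT₀m i) (htop i) (hAwin i) (hCle i) (hCle j) (hC0 i) (hAoff i) (hAoff j)
      (hsep i j hij) R
  -- ### assemble
  refine ⟨A, hAU, T₀, θ, β, Rr, S, Tlab, tcov, hAc, hAlate, hradii, hQA, fun i ↦ ?_, hconvR, hdisjB, hT₀s,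
    hclock, htop, hhon, hθtop, fun i t ht ↦ (hθbd i t ht).2, hβ0, hβB, hslack, hRrm, hRrt, hRrc, hreach,
    fun i n x hx hw hxr hxn ↦ ?_, fun i y hy hyr ↦ ?_⟩
  · exact isOpenEmbedding_restChart (M i) (a i) U Φ (A i) (hAU i) hembΦ (hAe i) (hAlate0 i)
  · rw [← hrad] at hxr hxn ⊢
    have hw' : 16 * γ ^ 2 * ((n : ℝ) + |a i|) ≤ x 0 / 2 := by linarith
    exact htcov i n x hx hw' hxr hxn
  · rw [← hrad]
    exact hTlab i y hy hyr

end Summit.FinalStateConjecture.FinalStateConjecture.Theorems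

end
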